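import Summits.AtomisticToContinuum.HydrodynamicLimit.Theorems.AntiMazurCoboundariesKineticWindowGronwallReorthCutPrelim
import HarnessLib

/-!
# The thermal-frame cut-off and the Gaussian identities of the product decomposition
# (helper file 1 of 3 toward stub `stub_productKineticInstance`, line `rare-band-ladder-dock`,
# crux `KineticWindowGronwall`, stmt-AtomisticToContinuum-9282)

Support file (`--supports stmt-AtomisticToContinuum-9282`) for the registered stub
`stub_productKineticInstance : ProductKineticInstance` (`LocalQuadraticWindowLDFamily → KineticInstanceOut`)
of the lead's skeleton `Cruxes/KineticWindowGronwall/Lines/rare_band_ladder_dock.lean` (§1b). The product node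
of the line feeds the landed kinetic instance KC1 through TWELVE thermal-frame products `φₘ(s,x) gₘ(w̃)`,
`w̃ = (v − u_s(x))/√θ_s(x)`, with `gₘ` continuous, x-INDEPENDENT, of quadratic growth and orthogonal to the
collision invariants `1, w̃, ‖w̃‖²` under the standard Gaussian `γ`. This file supplies the static Gaussian
analysis of the two kinds of factors `gₘ`:

* orthogonality to `span{1, w, ‖w‖²}` in `L²(γ)` (the clause `Orth` of the line) from the three moment identities is
  the landed `KineticWindowGronwallReorthCut.orth_of_moments` (worker file `…ReorthCutPrelim`, imported);
* §1 the TRACELESS THERMAL STRESS `Γ_jk(w) = w_j w_k − δ_jk ‖w‖²/3`: quadratic growth (`abs_stress_le`),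
  `∫ Γ_jk κ(‖w‖²) dγ = 0` for every radial weight of linear growth (`integral_stress_mul_weight`: reflections
  kill `j ≠ k`, `E[w_j² κ] = E‖w‖²κ/3` on the diagonal), hence `Orth (c Γ_jk)` (`stress_orth`; first moments by
  oddness);
* §2 the RE-ORTHOGONALISED THERMAL CUT-OFF `G̃` (`exists_thermalCutoff`): for every level `L > 0` a continuous
  `G̃ : ℝ → ℝ`, bounded on `r ≥ 0`, with `G̃ r = r − 5` for `r ≤ L` and `E[w₀² G̃(‖w‖²)] = 0` — the construction
  of the landed `ClampedCurrentsDockCutoff.stub_loHeatFluxCutoff` at `θ ≡ 1` (no parameter):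
  `G̃(r) = (r − 5)χ_L(r) − (R/m₀) r₀(r)`, `χ_L = min 1 (max 0 (2 − r/L))`, tent `r₀` above `L`,
  `m₀ = E[w₀² r₀(‖w‖²)] > 0`, `R = E[w₀²(‖w‖² − 5)χ_L(‖w‖²)]`; and `Orth (c · w_k G̃(‖w‖²))` (`flux_orth`:
  `⊥ 1, ‖w‖²` by oddness, `⊥ w_l` by `E[w_k w_l G̃] = δ_kl E[w₀² G̃] = 0`);
* §3 the pointwise algebra of the product decomposition of KC1's class member in the thermal frame
  (`stress_term_eq`, `flux_term_eq`, `lo_split`);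
* §4 the registered helper statement `ThermalCutoffToolkit` / `stub_thermalCutoffToolkit` (§1–§3 packaged).
-/

noncomputable section

namespace Summit.AtomisticToContinuum.HydrodynamicLimit.Theorems.KineticWindowGronwallProductKineticInstance

open MeasureTheory Filter Set Topology
open Literature.MathematicalPhysics.KineticTheory Literature.Analysis.FluidPDE Literature.Analysis.FunctionSpaces
open ProbabilityTheory
open Summit.AtomisticToContinuum.HydrodynamicLimit.Theorems.KineticCurrentsWindowLDUniformSketch.ClassTruncation
open Summit.AtomisticToContinuum.HydrodynamicLimit.Theorems.ClampedCurrentsDockCutoff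
open Summit.AtomisticToContinuum.HydrodynamicLimit.Theorems.KineticFluxLdDecayTilt
  (integral_eq_zero_of_odd_stdGaussian)
open Summit.AtomisticToContinuum.HydrodynamicLimit.Theorems.KineticWindowGronwallReorthCut (orth_of_moments)

/-! ## §1 The traceless thermal stress `Γ_jk(w) = w_j w_k − δ_jk ‖w‖²/3` -/

/-- `‖w‖² = Σ_l w_l w_l` on `ℝ³`. [folklore] -/
theorem norm_sq_eq_sum (w : V3) : ‖w‖ ^ 2 = ∑ l, w l * w l := by
  rw [EuclideanSpace.real_norm_sq_eq]
  exact Finset.sum_congr rfl fun l _ => sq (w l)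

/-- `‖w‖² κ(‖w‖²)` is Gaussian-integrable for a continuous radial weight of linear growth. [folklore] -/
theorem integrable_norm_sq_weight {κ : ℝ → ℝ} (hκ : Continuous κ) {P : ℝ}
    (hP : ∀ s, 0 ≤ s → |κ s| ≤ P * (1 + s)) :
    Integrable (fun w : V3 => ‖w‖ ^ 2 * κ (‖w‖ ^ 2)) (stdGaussian V3) := by
  have e : (fun w : V3 => ‖w‖ ^ 2 * κ (‖w‖ ^ 2)) = fun w => ∑ l, w l * w l * κ (‖w‖ ^ 2) := by
    funext w; rw [norm_sq_eq_sum, Finset.sum_mul]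
  rw [e]
  exact integrable_finsetSum _ fun l _ => integrable_coord_mul_weight l l hκ hP

/-- `∫ ‖w‖² κ(‖w‖²) dγ = 3 E[w₀² κ(‖w‖²)]`. [folklore] -/
theorem integral_norm_sq_weight {κ : ℝ → ℝ} (hκ : Continuous κ) {P : ℝ}
    (hP : ∀ s, 0 ≤ s → |κ s| ≤ P * (1 + s)) :
    ∫ w, ‖w‖ ^ 2 * κ (‖w‖ ^ 2) ∂stdGaussian V3 = 3 * ∫ w : V3, w 0 * w 0 * κ (‖w‖ ^ 2) ∂stdGaussian V3 := by
  have e : ∀ w : V3, ‖w‖ ^ 2 * κ (‖w‖ ^ 2) = ∑ l, w l * w l * κ (‖w‖ ^ 2) := fun w => by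
    rw [norm_sq_eq_sum, Finset.sum_mul]
  simp_rw [e]
  rw [integral_finsetSum _ fun l _ => integrable_coord_mul_weight l l hκ hP]
  simp only [Fin.sum_univ_three, integral_diag_eq]
  ring

/-- The traceless thermal stress is continuous. [folklore] -/
theorem continuous_stress (j k : Fin 3) :
    Continuous fun w : V3 => w j * w k - (if j = k then ‖w‖ ^ 2 / 3 else 0) := by
  by_cases h : j = k
  · simp only [h, if_true]; fun_prop
  · simp only [h, if_false]; fun_prop

/-- Quadratic growth of the traceless thermal stress: `|Γ_jk(w)| ≤ 2(1 + ‖w‖²)`. [folklore] -/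
theorem abs_stress_le (j k : Fin 3) (w : V3) :
    |w j * w k - (if j = k then ‖w‖ ^ 2 / 3 else 0)| ≤ 2 * (1 + ‖w‖ ^ 2) := by
  have hj : |w j| ≤ ‖w‖ := by simpa only [Real.norm_eq_abs] using PiLp.norm_apply_le w j
  have hk : |w k| ≤ ‖w‖ := by simpa only [Real.norm_eq_abs] using PiLp.norm_apply_le w k
  have h1 : |w j * w k| ≤ ‖w‖ ^ 2 := by
    rw [abs_mul, sq]; exact mul_le_mul hj hk (abs_nonneg _) (norm_nonneg _)
  have h2 : |(if j = k then ‖w‖ ^ 2 / 3 else 0 : ℝ)| ≤ ‖w‖ ^ 2 / 3 := by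
    split_ifs
    · rw [abs_of_nonneg (by positivity)]
    · rw [abs_zero]; positivity
  calc _ ≤ |w j * w k| + |(if j = k then ‖w‖ ^ 2 / 3 else 0 : ℝ)| := abs_sub _ _
    _ ≤ ‖w‖ ^ 2 + ‖w‖ ^ 2 / 3 := add_le_add h1 h2
    _ ≤ 2 * (1 + ‖w‖ ^ 2) := by nlinarith [sq_nonneg ‖w‖]

/-- **The traceless thermal stress is orthogonal to every radial weight**: `∫ Γ_jk κ(‖w‖²) dγ = 0` for a
continuous `κ` of linear growth (off the diagonal by the reflection `w_j ↦ −w_j`; on the diagonal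
`E[w_j² κ] − E[‖w‖² κ]/3 = E[w₀² κ] − E[w₀² κ] = 0`). [folklore] -/
theorem integral_stress_mul_weight (j k : Fin 3) {κ : ℝ → ℝ} (hκ : Continuous κ) {P : ℝ}
    (hP : ∀ s, 0 ≤ s → |κ s| ≤ P * (1 + s)) :
    ∫ w : V3, (w j * w k - if j = k then ‖w‖ ^ 2 / 3 else 0) * κ (‖w‖ ^ 2) ∂stdGaussian V3 = 0 := by
  by_cases hjk : j = k
  · subst hjk
    simp only [if_true]
    have e : ∀ w : V3, (w j * w j - ‖w‖ ^ 2 / 3) * κ (‖w‖ ^ 2) =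
        w j * w j * κ (‖w‖ ^ 2) - (1 / 3) * (‖w‖ ^ 2 * κ (‖w‖ ^ 2)) := fun w => by ring
    simp_rw [e]
    rw [integral_sub (integrable_coord_mul_weight j j hκ hP) ((integrable_norm_sq_weight hκ hP).const_mul _),
      integral_const_mul, integral_diag_eq, integral_norm_sq_weight hκ hP]
    ring
  · simp only [if_neg hjk, sub_zero]
    exact integral_offdiag_eq_zero hjk κ

/-- **`Orth (c Γ_jk)`**: every multiple of the traceless thermal stress is orthogonal to `span{1, w, ‖w‖²}` in
`L²(γ)` (`⊥ 1` and `⊥ ‖w‖²` by `integral_stress_mul_weight`, `⊥ w_l` by oddness). [folklore] -/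
theorem stress_orth (j k : Fin 3) (c c₀ c₂ : ℝ) (b : V3) :
    ∫ v : V3, c * (v j * v k - if j = k then ‖v‖ ^ 2 / 3 else 0) * (c₀ + inner ℝ b v + c₂ * ‖v‖ ^ 2)
      ∂stdGaussian V3 = 0 := by
  refine orth_of_moments (G := fun v : V3 => c * (v j * v k - if j = k then ‖v‖ ^ 2 / 3 else 0))
    (continuous_const.mul (continuous_stress j k)) (K := |c| * 2) (fun w => ?_) ?_ (fun l => ?_) ?_ c₀ c₂ b
  · rw [abs_mul, mul_assoc]
    exact mul_le_mul_of_nonneg_left (abs_stress_le j k w) (abs_nonneg c)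
  · have h := integral_stress_mul_weight j k (κ := fun _ => (1 : ℝ)) continuous_const (P := 1)
      (fun s hs => by rw [abs_one]; linarith)
    simp only [mul_one] at h
    rw [integral_const_mul, h, mul_zero]
  · refine integral_eq_zero_of_odd_stdGaussian fun w => ?_
    simp only [PiLp.neg_apply, norm_neg, mul_neg, neg_mul, neg_neg]
  · have h := integral_stress_mul_weight j k (κ := fun s => s) continuous_id (P := 1)
      (fun s hs => by rw [abs_of_nonneg hs]; linarith)
    have e : ∀ v : V3, c * (v j * v k - if j = k then ‖v‖ ^ 2 / 3 else 0) * ‖v‖ ^ 2 =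
        c * ((v j * v k - if j = k then ‖v‖ ^ 2 / 3 else 0) * ‖v‖ ^ 2) := fun v => by ring
    simp_rw [e]
    rw [integral_const_mul, h, mul_zero]

/-! ## §2 The re-orthogonalised thermal cut-off `G̃` and the flux factors `w_k G̃(‖w‖²)` -/

-- adapted from Summits/.../OneFlightGossipEngineClampedCurrentsDockCutoff.lean (`stub_loHeatFluxCutoff`),
-- specialised to the thermal frame `θ ≡ 1` (no parameter)
/-- **The re-orthogonalised thermal cut-off.** For every level `L > 0` there is a continuous `G̃ : ℝ → ℝ`,
bounded on `r ≥ 0`, equal to `r − 5` for `r ≤ L`, with `E[w₀² G̃(‖w‖²)] = 0` under the standard Gaussian: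
`G̃(r) = (r − 5)χ_L(r) − (R/m₀) r₀(r)` (module docstring). [folklore] -/
theorem exists_thermalCutoff {L : ℝ} (hL : 0 < L) :
    ∃ Gt : ℝ → ℝ, Continuous Gt ∧ (∃ C : ℝ, 0 ≤ C ∧ ∀ r, 0 ≤ r → |Gt r| ≤ C) ∧
      (∀ r, r ≤ L → Gt r = r - 5) ∧
      ∫ ξ : V3, ξ 0 * ξ 0 * Gt (‖ξ‖ ^ 2) ∂stdGaussian V3 = 0 := by
  /- the cutoff `χ = χ_L` and the tent `r₀` above `L` -/
  set χ : ℝ → ℝ := fun s => min 1 (max 0 (2 - s / L)) with hχ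
  have hχlo : ∀ s, s ≤ L → χ s = 1 := cutoff_eq_one hL (χ := χ) fun s => by rw [hχ]
  obtain ⟨hχc, hχ0, hχ1, hχhi, -⟩ := cutoff_props hL (χ := χ) fun s => by rw [hχ]
  clear_value χ
  set r₀ : ℝ → ℝ := fun t => max 0 (1 - |t - (L + 1)|) with hr₀
  obtain ⟨hr₀c, hr₀0, hr₀1, hr₀lo, -, hr₀one⟩ := tent_props L (r := r₀) fun t => by rw [hr₀]
  clear_value r₀
  have hr₀abs : ∀ t, 0 ≤ t → |r₀ t| ≤ 1 * (1 + t) := fun t ht =>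
    le_mul_one_add (by rw [abs_of_nonneg (hr₀0 t)]; exact hr₀1 t) zero_le_one ht
  /- the reference moment `m₀ = E[ξ₀² r₀(‖ξ‖²)] > 0` -/
  have hir₀ : Integrable (fun ξ : V3 => ξ 0 * ξ 0 * r₀ (‖ξ‖ ^ 2)) (stdGaussian V3) :=
    integrable_coord_mul_weight 0 0 hr₀c hr₀abs
  set m₀ : ℝ := ∫ ξ, ξ 0 * ξ 0 * r₀ (‖ξ‖ ^ 2) ∂stdGaussian V3 with hm₀def
  have hm₀ : 0 < m₀ := by
    haveI := isOpenPosMeasure_stdGaussian_V3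
    have hpt : (EuclideanSpace.single (0 : Fin 3) (Real.sqrt (L + 1)) : V3) 0 = Real.sqrt (L + 1) := by
      simp
    have hn : ‖(EuclideanSpace.single (0 : Fin 3) (Real.sqrt (L + 1)) : V3)‖ ^ 2 = L + 1 := by
      rw [PiLp.norm_single, Real.norm_eq_abs, sq_abs, Real.sq_sqrt (by positivity)]
    rw [hm₀def]
    refine integral_pos_of_integrable_nonneg_nonzero
      (x := (EuclideanSpace.single (0 : Fin 3) (Real.sqrt (L + 1)) : V3)) (by fun_prop) hir₀
      (fun ξ => mul_nonneg (mul_self_nonneg _) (hr₀0 _)) ?_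
    beta_reduce
    rw [hpt, hn, hr₀one, mul_one, Real.mul_self_sqrt (by positivity)]
    positivity
  clear_value m₀
  /- the truncated profile and its second radial moment `R` -/
  have hq : ∀ s, 0 ≤ s → |(s - 5) * χ s| ≤ 2 * L + 5 := by
    intro s hs
    by_cases h : s ≤ 2 * L
    · rw [abs_mul, abs_of_nonneg (hχ0 s)]
      calc |s - 5| * χ s ≤ |s - 5| * 1 := mul_le_mul_of_nonneg_left (hχ1 s) (abs_nonneg _)
        _ ≤ 2 * L + 5 := by
            rw [mul_one]
            refine (abs_sub _ _).trans ?_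
            rw [abs_of_nonneg hs, abs_of_nonneg (by norm_num : (0 : ℝ) ≤ 5)]
            linarith
    · rw [hχhi s (not_le.1 h).le, mul_zero, abs_zero]; positivity
  have hi1 : Integrable (fun ξ : V3 => ξ 0 * ξ 0 * ((‖ξ‖ ^ 2 - 5) * χ (‖ξ‖ ^ 2))) (stdGaussian V3) :=
    integrable_coord_mul_weight 0 0 (ω := fun t => (t - 5) * χ t) (by fun_prop) (P := 2 * L + 5)
      (fun t ht => le_mul_one_add (hq t ht) (by positivity) ht)
  set R : ℝ := ∫ ξ : V3, ξ 0 * ξ 0 * ((‖ξ‖ ^ 2 - 5) * χ (‖ξ‖ ^ 2)) ∂stdGaussian V3 with hR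
  /- the profile -/
  refine ⟨fun r => (r - 5) * χ r - R / m₀ * r₀ r, by fun_prop,
    ⟨2 * L + 5 + |R / m₀|, by positivity, fun r hr => ?_⟩, fun r hr => ?_, ?_⟩
  · show |(r - 5) * χ r - R / m₀ * r₀ r| ≤ 2 * L + 5 + |R / m₀|
    refine (abs_sub _ _).trans (add_le_add (hq r hr) ?_)
    rw [abs_mul]
    exact (mul_le_mul_of_nonneg_left (by rw [abs_of_nonneg (hr₀0 r)]; exact hr₀1 r)
      (abs_nonneg _)).trans (le_of_eq (mul_one _))
  · show (r - 5) * χ r - R / m₀ * r₀ r = r - 5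
    rw [hχlo r hr, hr₀lo r hr]; ring
  · have e : ∀ ξ : V3, ξ 0 * ξ 0 * ((‖ξ‖ ^ 2 - 5) * χ (‖ξ‖ ^ 2) - R / m₀ * r₀ (‖ξ‖ ^ 2)) =
        ξ 0 * ξ 0 * ((‖ξ‖ ^ 2 - 5) * χ (‖ξ‖ ^ 2)) - R / m₀ * (ξ 0 * ξ 0 * r₀ (‖ξ‖ ^ 2)) := fun ξ => by
      ring
    simp_rw [e]
    rw [integral_sub hi1 (hir₀.const_mul _), integral_const_mul, ← hR, ← hm₀def,
      div_mul_cancel₀ _ hm₀.ne', sub_self]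

/-- Quadratic growth of the flux factor: `|w_k G̃(‖w‖²)| ≤ C(1 + ‖w‖²)` if `|G̃| ≤ C` on `r ≥ 0`. [folklore] -/
theorem abs_flux_le (k : Fin 3) {Gt : ℝ → ℝ} {C : ℝ} (hC : ∀ r, 0 ≤ r → |Gt r| ≤ C) (w : V3) :
    |w k * Gt (‖w‖ ^ 2)| ≤ C * (1 + ‖w‖ ^ 2) := by
  have h2 := hC _ (sq_nonneg ‖w‖)
  have hC0 : 0 ≤ C := (abs_nonneg _).trans h2
  rw [abs_mul]
  calc |w k| * |Gt (‖w‖ ^ 2)| ≤ (1 + ‖w‖ ^ 2) * C :=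
        mul_le_mul (abs_coord_le w k) h2 (abs_nonneg _) (by positivity)
    _ = C * (1 + ‖w‖ ^ 2) := mul_comm _ _

/-- **`Orth (c · w_k G̃(‖w‖²))`**: with `E[w₀² G̃(‖w‖²)] = 0`, every multiple of the flux factor is orthogonal to
`span{1, w, ‖w‖²}` in `L²(γ)` (`⊥ 1, ‖w‖²` by oddness; `E[w_k w_l G̃] = δ_kl E[w₀² G̃] = 0`). [folklore] -/
theorem flux_orth (k : Fin 3) (c : ℝ) {Gt : ℝ → ℝ} (hGt : Continuous Gt) {C : ℝ}
    (hC : ∀ r, 0 ≤ r → |Gt r| ≤ C) (hm : ∫ ξ : V3, ξ 0 * ξ 0 * Gt (‖ξ‖ ^ 2) ∂stdGaussian V3 = 0)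
    (c₀ c₂ : ℝ) (b : V3) :
    ∫ v : V3, c * (v k * Gt (‖v‖ ^ 2)) * (c₀ + inner ℝ b v + c₂ * ‖v‖ ^ 2) ∂stdGaussian V3 = 0 := by
  refine orth_of_moments (G := fun v : V3 => c * (v k * Gt (‖v‖ ^ 2))) (by fun_prop) (K := |c| * C)
    (fun w => ?_) ?_ (fun l => ?_) ?_ c₀ c₂ b
  · rw [abs_mul, mul_assoc]
    exact mul_le_mul_of_nonneg_left (abs_flux_le k hC w) (abs_nonneg c)
  · exact integral_eq_zero_of_odd_stdGaussian fun w => by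
      simp only [PiLp.neg_apply, norm_neg]; ring
  · have e : ∀ v : V3, c * (v k * Gt (‖v‖ ^ 2)) * v l = c * (v k * v l * Gt (‖v‖ ^ 2)) := fun v => by
      ring
    simp_rw [e]
    rw [integral_const_mul]
    by_cases hkl : k = l
    · subst hkl; rw [integral_diag_eq, hm, mul_zero]
    · rw [integral_offdiag_eq_zero hkl, mul_zero]
  · exact integral_eq_zero_of_odd_stdGaussian fun w => by
      simp only [PiLp.neg_apply, norm_neg]; ring

/-! ## §3 The pointwise algebra of the thermal-frame product decomposition -/

/-- The scaled peculiar velocity: `‖s⁻¹ • w‖² = (s s)⁻¹ ‖w‖²` for `s > 0`. [folklore] -/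
theorem norm_sq_inv_smul {s : ℝ} (hs : 0 < s) (w : V3) :
    ‖s⁻¹ • w‖ ^ 2 = (s * s)⁻¹ * ‖w‖ ^ 2 := by
  rw [norm_smul, norm_inv, Real.norm_eq_abs, abs_of_pos hs, mul_pow, inv_pow, sq]

/-- The stress term of KC1's class member in the thermal frame `w̃ = w/s`, `s² = θ`:
`12β · θ⁻¹ Γ_jk(w) D = (24β/c⋆ · D) · (c⋆/2 · Γ_jk(w̃))`. [folklore] -/
theorem stress_term_eq {s : ℝ} (hs : 0 < s) {cstar : ℝ} (hc : cstar ≠ 0) (β D : ℝ) (j k : Fin 3)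
    (w : V3) :
    12 * β * ((s * s)⁻¹ * ((w j * w k - if j = k then ‖w‖ ^ 2 / 3 else 0) * D)) =
      24 * β / cstar * D *
        (cstar / 2 * ((s⁻¹ • w) j * (s⁻¹ • w) k - if j = k then ‖s⁻¹ • w‖ ^ 2 / 3 else 0)) := by
  simp only [PiLp.smul_apply, smul_eq_mul, norm_sq_inv_smul hs]
  have hs0 : s ≠ 0 := hs.ne'
  split_ifs <;> field_simp <;> ring

/-- The flux term of KC1's class member in the thermal frame `w̃ = w/s`, `s² = θ`, with the cut-off
`G(x, r) = θ G̃(r/θ)`: `12β · (Dθ/(2θ²)) w_k · θ G̃(‖w‖²/θ) = (12β C/c⋆ · Dθ/(2s)) · (c⋆/C · w̃_k G̃(‖w̃‖²))`.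
[folklore] -/
theorem flux_term_eq {s : ℝ} (hs : 0 < s) {cstar C : ℝ} (hc : cstar ≠ 0) (hC : C ≠ 0) (β Dθ : ℝ)
    (Gt : ℝ → ℝ) (k : Fin 3) (w : V3) :
    12 * β * (Dθ / (2 * (s * s) ^ 2) * w k * ((s * s) * Gt (‖w‖ ^ 2 / (s * s)))) =
      12 * β * C / cstar * (Dθ / (2 * s)) * (cstar / C * ((s⁻¹ • w) k * Gt (‖s⁻¹ • w‖ ^ 2))) := by
  simp only [PiLp.smul_apply, smul_eq_mul, norm_sq_inv_smul hs]
  have hs0 : s ≠ 0 := hs.ne'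
  rw [div_eq_inv_mul (‖w‖ ^ 2)]
  field_simp

/-- **The product decomposition of KC1's class member in the thermal frame.** With `s = √θ`, `w̃ = w/s`,
`G(x,r) = θ G̃(r/θ)` and twelve products indexed by `(j,k) ∈ Fin 3 × Fin 3` (stresses) and `k ∈ Fin 3` (fluxes):
`β · lo = 12⁻¹ (Σ_{j,k} φ_jk g_jk(w̃) + Σ_k φ_k g_k(w̃))` with `g_jk = (c⋆/2)Γ_jk`, `φ_jk = (24β/c⋆)D_jk`,
`g_k = (c⋆/C) w̃_k G̃(‖w̃‖²)`, `φ_k = (12βC/c⋆) Dθ_k/(2s)`. [folklore] -/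
theorem lo_split {s : ℝ} (hs : 0 < s) {cstar C : ℝ} (hc : cstar ≠ 0) (hC : C ≠ 0) (β : ℝ)
    (D : Fin 3 → Fin 3 → ℝ) (Dθ : Fin 3 → ℝ) (Gt : ℝ → ℝ) (w : V3) :
    β * ((s * s)⁻¹ * ∑ j, ∑ k, (w j * w k - if j = k then ‖w‖ ^ 2 / 3 else 0) * D j k +
        (∑ k, Dθ k / (2 * (s * s) ^ 2) * w k) * ((s * s) * Gt (‖w‖ ^ 2 / (s * s)))) =
      (12 : ℝ)⁻¹ * ((∑ j, ∑ k, 24 * β / cstar * D j k *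
          (cstar / 2 * ((s⁻¹ • w) j * (s⁻¹ • w) k - if j = k then ‖s⁻¹ • w‖ ^ 2 / 3 else 0))) +
        ∑ k, 12 * β * C / cstar * (Dθ k / (2 * s)) * (cstar / C * ((s⁻¹ • w) k * Gt (‖s⁻¹ • w‖ ^ 2)))) := by
  have hS : (∑ j, ∑ k, 24 * β / cstar * D j k *
      (cstar / 2 * ((s⁻¹ • w) j * (s⁻¹ • w) k - if j = k then ‖s⁻¹ • w‖ ^ 2 / 3 else 0))) =
      ∑ j, ∑ k, 12 * β * ((s * s)⁻¹ * ((w j * w k - if j = k then ‖w‖ ^ 2 / 3 else 0) * D j k)) :=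
    Finset.sum_congr rfl fun j _ => Finset.sum_congr rfl fun k _ => (stress_term_eq hs hc β (D j k) j k w).symm
  have hF : (∑ k, 12 * β * C / cstar * (Dθ k / (2 * s)) * (cstar / C * ((s⁻¹ • w) k * Gt (‖s⁻¹ • w‖ ^ 2)))) =
      ∑ k, 12 * β * (Dθ k / (2 * (s * s) ^ 2) * w k * ((s * s) * Gt (‖w‖ ^ 2 / (s * s)))) :=
    Finset.sum_congr rfl fun k _ => (flux_term_eq hs hc hC β (Dθ k) Gt k w).symm
  rw [hS, hF]
  simp only [← Finset.mul_sum, Finset.sum_mul]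
  ring

/-! ## §4 The registered helper statement -/

/-- Helper statement `ThermalCutoffToolkit` (helper stub of `stub_productKineticInstance`, line rare-band-ladder-dock,
file 1 of 3): the re-orthogonalised thermal cut-off exists at every level `L > 0`, and every multiple of a traceless
thermal stress `Γ_jk` or of a flux factor `w_k G̃(‖w‖²)` (with `E[w₀² G̃(‖w‖²)] = 0`) is orthogonal to the collision
invariants `1, w, ‖w‖²` under the standard Gaussian; and the pointwise product decomposition of KC1's class member in
the thermal frame — route-internal, not a cited fact. -/
def ThermalCutoffToolkit : Prop :=
  (∀ L : ℝ, 0 < L → ∃ Gt : ℝ → ℝ, Continuous Gt ∧ (∃ C : ℝ, 0 ≤ C ∧ ∀ r, 0 ≤ r → |Gt r| ≤ C) ∧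
      (∀ r, r ≤ L → Gt r = r - 5) ∧ ∫ ξ : V3, ξ 0 * ξ 0 * Gt (‖ξ‖ ^ 2) ∂stdGaussian V3 = 0) ∧
  (∀ (j k : Fin 3) (c c₀ c₂ : ℝ) (b : V3),
      ∫ v : V3, c * (v j * v k - if j = k then ‖v‖ ^ 2 / 3 else 0) * (c₀ + inner ℝ b v + c₂ * ‖v‖ ^ 2)
        ∂stdGaussian V3 = 0) ∧
  (∀ (k : Fin 3) (c : ℝ) (Gt : ℝ → ℝ), Continuous Gt → ∀ C : ℝ, (∀ r, 0 ≤ r → |Gt r| ≤ C) →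
      ∫ ξ : V3, ξ 0 * ξ 0 * Gt (‖ξ‖ ^ 2) ∂stdGaussian V3 = 0 → ∀ (c₀ c₂ : ℝ) (b : V3),
      ∫ v : V3, c * (v k * Gt (‖v‖ ^ 2)) * (c₀ + inner ℝ b v + c₂ * ‖v‖ ^ 2) ∂stdGaussian V3 = 0) ∧
  (∀ s : ℝ, 0 < s → ∀ cstar C : ℝ, cstar ≠ 0 → C ≠ 0 →
    ∀ (β : ℝ) (D : Fin 3 → Fin 3 → ℝ) (Dθ : Fin 3 → ℝ) (Gt : ℝ → ℝ) (w : V3),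
    β * ((s * s)⁻¹ * ∑ j, ∑ k, (w j * w k - if j = k then ‖w‖ ^ 2 / 3 else 0) * D j k +
        (∑ k, Dθ k / (2 * (s * s) ^ 2) * w k) * ((s * s) * Gt (‖w‖ ^ 2 / (s * s)))) =
      (12 : ℝ)⁻¹ * ((∑ j, ∑ k, 24 * β / cstar * D j k *
          (cstar / 2 * ((s⁻¹ • w) j * (s⁻¹ • w) k - if j = k then ‖s⁻¹ • w‖ ^ 2 / 3 else 0))) +
        ∑ k, 12 * β * C / cstar * (Dθ k / (2 * s)) * (cstar / C * ((s⁻¹ • w) k * Gt (‖s⁻¹ • w‖ ^ 2)))))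

/-- **Registered helper stub `stub_thermalCutoffToolkit`** (helper of `stub_productKineticInstance`, line
rare-band-ladder-dock, file 1 of 3): `ThermalCutoffToolkit` holds (`exists_thermalCutoff`, `stress_orth`, `flux_orth`,
`lo_split`). [folklore] -/
theorem stub_thermalCutoffToolkit : ThermalCutoffToolkit :=
  ⟨fun _ hL => exists_thermalCutoff hL, fun j k c c₀ c₂ b => stress_orth j k c c₀ c₂ b,
    fun k c _ hGt _ hC hm c₀ c₂ b => flux_orth k c hGt hC hm c₀ c₂ b,
    fun _ hs _ _ hc hC β D Dθ Gt w => lo_split hs hc hC β D Dθ Gt w⟩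

end Summit.AtomisticToContinuum.HydrodynamicLimit.Theorems.KineticWindowGronwallProductKineticInstance

end
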